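import Summits.QuantumFields.YangMills.Theorems.BalabanUVNodesN16H7NoBinding
import Summits.QuantumFields.YangMills.Theorems.BalabanUVNodesN16PinnedLooseMatch
import Summits.QuantumFields.BalabanUV.T4Continuum.Support.MinimalActionClassAgnostic
import Summits.QuantumFields.BalabanUV.T4Continuum.Support.LevelZeroRegular
import HarnessLib

/-!
# Route «BalabanUVNodes» (K3⁷ `SpineGivenEndpointR13SepCoPH`, stmt-QuantumFields-20544), DAG node N16 = NE3 — THE INTERIOR LETTER IS CAPTURE:
# node N19's value-letter clause `LeafH3sup … ε b c' dom` (`b < ε`) at the N16 → N19 junction ⟺ «every minimiser over `sfClass ε` at a datum of `dom` lies in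
# `sfClass b`» (CAPTURE), the forward direction in the kernel, the converse modulo [B11] Theorem 1 at leaf-06's torus instances; and the producer of the
# (v′-16) rows `LeafH3sup` ∕ `sel` under K3⁷ v5's LOOSE pin from CAPTURE + Theorem 1

Cell `pub-ymgap`, width seat `pub-ymgap-dag-n16-w1` (director-ym №197 ∕ HUMAN RULING D-0149), generation 4, file 7 of the lineage (files 1–6: `…N16H7OfReg9` p584527,
`…N16H7TightWindow` p586490, `…N16H7OfN07RecordSlot` p588364, `…N16H7NoBinding` p593465, `…N16H7Fronts` p596237∕p600107, `…N16H7LooseOfThm1At` p597330∕p599040∕p602214).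
`--kind proof --supports stmt-QuantumFields-20544 --as helper` (count-neutral; proves NO registered stub).  `bears_on: R4∕N16 · edge N07 → N16 · junction N16 → N19`.
Answers, at decl level, dag-n16-e g16's LOCATED note (t-N16c) «THE INTERIOR LETTER `b`» (pub-ymgap INBOX l.28667, HOME `pub-ymgap-dag-n16-e/LOCATED-N16-INTERIOR-LETTER.md`).

THE POINT.  K3⁷ v5 (941dddb108cbaacf) pins node N16's layer LOOSE (`N16PinnedLayer13CoPH.N16PinnedLoose 𝔯 ℓ₃ B`: the NE3 data are the `2L^m`-periodic data of (7)-size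
`≤ (ℓ₃ F).ε ∕ B F`) with THE END's letter rows `N16LettersEnd` (among them `b ≤ ε∕2`) and the MATCH row `(ℓ₃ F).ε ∕ B F ≤ (ℓ₃ F).b`.  Node N19's link reading
(`…N19RateEdgeHolderD4` (v′-16) :194–201) then DISPLAYS, at `R := rateCarriersOfRecord₁₃CoPH 𝔯 F θ hP g₀ os k`, `LeafH3sup 4 R.ne3.L R.ne3.Nper R.ne3.ε R.ne3.b c' R.ne3.dom`
(every minimiser of every run `k+1` over the class of radius `R.ne3.ε` at a datum of `R.ne3.dom` has sup-form regularity with VALUE letter `R.ne3.b ≤ R.ne3.ε∕2`) and two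
`sel` rows.  (t-N16c): these rows have NO producer — the tree's only print road to sup-regularity (file 1's `leafH3sup_loose_of_thm1At_torusVP`) yields VALUE LETTER = CLASS
RADIUS, because leaf-06's `torusVP` reads (8) as «minimiser over the class of radius EXACTLY `B₃ε₁`» and drops print's uniqueness clause (D-s3-5 `UniqueCriticalOrbit := True`;
closed classes, D-s3-1).  THIS FILE shows that the open content of the junction is EXACTLY ONE membership statement:
  CAPTURE(ε → ρ) on `D` := `∀ V ∈ D, ∀ k U, IsMinimiser d (sfClass d L N ε) L N (k+1) V U → U ∈ sfClass d L N ρ (k+1)`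
(print's own picture: (8) puts THE minimal orbit in `𝔘(B₃ε₁)`, and the uniqueness clause of [Balaban1985Variational] Thm 1 p. 279 L8–13 «This orbit is a unique critical
orbit in the space (6) if B₃ε₁ ≤ ε₀ and ε₀ ≤ a₀» with the open∕closed squeeze makes every minimiser over the larger class that orbit).  (§1) the clause `LeafH3sup d L N ε b c D`
literally CONTAINS CAPTURE(ε → b) (`RegularSup.small` + unitarity + periodicity = class membership): no re-keying of letters produces the interior letter without it; (§2)
conversely CAPTURE(ε → ρ) into a Theorem-1 radius `0 < ρ ≤ min(ε, B₃a₁, 1∕28)` on data loose at `ρ∕B₃` plus the displayed `hT : ∀ k, Thm1At C (torusVP d L N G (k+1))` gives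
`LeafH3sup d L N ε ρ (16937ρ) D` (a captured `ε`-minimiser IS a `ρ`-minimiser — file 4's `isMinimiser_of_inflate_of_mem` — and file 1 §3 at radius `ρ` gives (9)–(10)); so
`LeafH3sup d L N ε ρ (16937ρ) D ↔ CAPTURE(ε → ρ)` under `hT`.  §3: (8) at `ε₁ = ε∕B₃` gives minimisers of every run `k+1` over `sfClass ε` at loose data (row `ε ≤ B₃a₁`),
captured hence regular; at run `0` the datum is its own minimiser with the trivial level-0 leaf (`Support/LevelZeroRegular`; N19's rows `ε₁ ≤ 1∕4, ε₁ ≤ b, 4ε₁ ≤ c'`).  §4 writes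
both at K3⁷ v5's LOOSE PIN: under `N16PinnedLoose 𝔯 ℓ₃ B`, a capture radius `ρ : T4Family → ℝ` with rows `0 < ρ F ≤ min((ℓ₃ F).ε, (C F).B₃·(C F).a₁, 1∕28)`,
`(ℓ₃ F).ε ∕ B F ≤ ρ F ∕ (C F).B₃`, the TIGHTENED MATCH ROW `ρ F ≤ (ℓ₃ F).b`, `16937·ρ F ≤ c'`, CAPTURE((ℓ₃ F).ε → ρ F) at the pinned loose object and the per-family Theorem-1
reading (`G F`, `hGm`, `hG`, `C F`, `hM`, `hT` exactly as in files 1–6 and dag-n16-e's module 45) ⟹ N19's (v′-16) conjunct at EVERY tuple and run length, the instance at print's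
radius `ρ F := (C F).B₃·((ℓ₃ F).ε ∕ B F)` (match row tightened to `(C F).B₃·(ℓ₃ F).ε ∕ B F ≤ (ℓ₃ F).b`, as dag-n16-e's §5 (R1) predicted), and the `sel` rows.

WHAT THIS FILE PROVES (kernel; theorems only, 0 `def`, 0 sorry; BY NAME over landed modules, none edited).  §1 `capture_of_leafH3sup` (NECESSITY), `capture_self` (ρ = ε: the
trivially inhabited case — A6 hygiene; the content is at `ρ < ε`), `isMinimiser_of_capture`, `capture_trans`, `capture_mono_outer` (CAPTURE(ε → ρ) ∧ an `ε`-minimiser exists ⟹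
CAPTURE(ε′ → ρ) for `ρ ≤ ε′ ≤ ε`), `minAct_eq_of_capture` (VALUE no-binding downward on `[ρ, ε]`).  §2 ★ `leafH3sup_interior_of_thm1At_torusVP_of_capture` (whence any letters `b ≥ ρ`, `c ≥ 16937ρ` by file 1's
`leafH3sup_mono`), ★ `leafH3sup_interior_iff_capture`.  §3 `exists_isMinimiser_succ_of_thm1At_torusVP`, `exists_sel_succ_of_thm1At_torusVP_of_capture`,
`exists_sel_of_thm1At_torusVP_of_capture`.  §4 ★ `leafH3sup_rateCarriers_of_pinnedLoose_of_capture`, `leafH3sup_rateCarriers_of_pinnedLoose_of_capture_B₃`,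
`sel_rateCarriers_of_pinnedLoose_of_capture`.

HONEST FRAMING.  Elementary nested-class logic + bookkeeping over landed theorems BY NAME.  CAPTURE (membership form) is a DISPLAYED hypothesis asserted for no family: it is
print's picture (Thm 1 (8) + the uniqueness clause p. 279 L8–13) and exactly what leaf-06's dictionary drops (D-s3-5, D-s3-1); THIS FILE DOES NOT PROVE IT (that is Theorem 1's
uniqueness content at the tree's objects, L-sized) — it shows the junction's open content IS capture and nothing more, and supplies the (v′-16) rows modulo it.  This lineage's
FRONTS finding (evidence #27, tight window) does NOT bear on loose data.  [B11] Thm 1 = the displayed `Thm1At` for leaf-06's instances (divergences D-s3-1…6).  Nothing of Bałaban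
asserted or refuted; no stub of K3⁷ closed; N16 ∕ N19 NOT discharged; count-neutral; counts of record unmoved (typed 28∕28 · discharged 5∕27 · A 5∕28); one finite four-torus at
fixed `ε`, Bałaban AS PRINTED — NOT ℝ⁴, NOT infinite volume, NOT OS, NOT a mass gap; the YM mass gap (Clay) is NOT proved by any of this — R4 closes the conditional finite-𝕋⁴ rung
`BalabanLadder.UV` only.
-/

set_option autoImplicit false

open scoped BigOperators Matrix Matrix.Norms.L2Operator
open NormedSpace

namespace Summit.QuantumFields.YangMills.BalabanUVNodes.N16InteriorOfCapture

open Literature.MathematicalPhysics.QuantumFieldTheory.Balaban1983to89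
open Literature.MathematicalPhysics.QuantumFieldTheory.Balaban1983to89.T4Continuum (T4Family ULoop)
open B7Prop1Explicit B7Prop2Explicit MatrixLog UnitaryModel
open T4AveragingDeficitWall hiding Site Plane Plaq Bond
open Summit.QuantumFields.BalabanUV.T4Continuum
open AveragingDeficitLatticeH2Prep (fd)
open MinimalActionSandwich (IsMinimiser admissible minAct)
open MinimalActionRate (sfClass)
open MinimalActionRefine (RegularSup)
open MinimalActionDictionary (torusVP RadiiMono sfClass_mono isMinimiser_zero)
open MinimalActionClassAgnostic (mem_sfClass_of_regularSup)
open LevelZeroRegular (regularSup_zero_of_sfClass_le)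
open NE3.LeafIndexSockets (LeafH3sup)
open B11Thm1 (Thm1At)
open Node00 (Stage13HParams NE3Letters₁₁ ne3ConstLayerOfRecord₁₁ ne3NperOfRecord₁₁ ne3DomOfRecord₁₁ MatA)
open YMDAG.UVSplit (NE3Carriers ne3OfRecord₁₁ RateReading₁₃CoPH rateCarriersOfRecord₁₃CoPH)
open Summit.QuantumFields.YangMills.BalabanUVNodes.N16H7OfReg9 (leafH3sup_mono leafH3sup_loose_of_thm1At_torusVP)
open Summit.QuantumFields.YangMills.BalabanUVNodes.N16H7NoBinding (isMinimiser_of_inflate_of_mem isMinimiser_inflate_of_minAct_le)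
open Summit.QuantumFields.YangMills.BalabanUVNodes.N16PinnedLayer13CoPH (N16PinnedLoose rateCarriers_ne3_of_pinnedLoose)
open Summit.QuantumFields.YangMills.BalabanUVNodes.N16PinnedDataSmallField (sfClass_zero_mono)

noncomputable section

section Generic

variable {d : ℕ} {n : Type} [Fintype n] [DecidableEq n]

/-! ## §1 CAPTURE: necessity for the interior letter, and its elementary structure -/

/-- **★ NECESSITY — THE INTERIOR LETTER IS A CAPTURE STATEMENT.**  If every minimiser of every run `k+1` over `sfClass d L N ε` at a datum of `D` has sup-form regularity with
value letter `b` (`LeafH3sup d L N ε b c D` — node N19's (v′-16) clause shape), then every such minimiser LIES IN the class of radius `b`: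
CAPTURE(ε → b) on `D`.  One line: `RegularSup.small` + unitarity + periodicity = membership (`MinimalActionClassAgnostic.mem_sfClass_of_regularSup`).  For `b < ε` this is the
«closed-class bridge» of dag-n16-e's (t-N16c) §5 (R1) — so that bridge is not an option but the CONTENT of the clause. [folklore] -/
theorem capture_of_leafH3sup {L N : ℕ} {ε b c : ℝ} {D : Set (Site d → Fin d → (Matrix n n ℂ)ˣ)} (h : LeafH3sup d L N ε b c D) :
    ∀ V ∈ D, ∀ (k : ℕ) (U : Site d → Fin d → (Matrix n n ℂ)ˣ), IsMinimiser d (sfClass d L N ε) L N (k + 1) V U → U ∈ sfClass d L N b (k + 1) :=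
  fun V hV k U hU => mem_sfClass_of_regularSup le_rfl (h V hV k U hU)

/-- **CAPTURE(ε → ε) HOLDS TRIVIALLY** (a minimiser is admissible, hence in its own class): the displayed hypothesis of §2–§4 is inhabited at `ρ = ε`, where §2 returns exactly
file 1's loose leaf `LeafH3sup d L N ε ε (16937ε)`; the content of CAPTURE is at `ρ < ε` (A6 hygiene: said, not hidden). [folklore] -/
theorem capture_self {L N : ℕ} {ε : ℝ} {D : Set (Site d → Fin d → (Matrix n n ℂ)ˣ)} :
    ∀ V ∈ D, ∀ (k : ℕ) (U : Site d → Fin d → (Matrix n n ℂ)ˣ), IsMinimiser d (sfClass d L N ε) L N (k + 1) V U → U ∈ sfClass d L N ε (k + 1) :=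
  fun _ _ _ _ hU => hU.mem.1

/-- **A CAPTURED `ε`-MINIMISER IS A `ρ`-MINIMISER** (`ρ ≤ ε`): it is admissible for the smaller class and beats every competitor there (file 4's `isMinimiser_of_inflate_of_mem`
with `MinimalActionDictionary.sfClass_mono`). [folklore] -/
theorem isMinimiser_of_capture {L N k : ℕ} {ε ρ : ℝ} (hρε : ρ ≤ ε) {V U : Site d → Fin d → (Matrix n n ℂ)ˣ}
    (hU : IsMinimiser d (sfClass d L N ε) L N k V U) (hmem : U ∈ sfClass d L N ρ k) : IsMinimiser d (sfClass d L N ρ) L N k V U :=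
  isMinimiser_of_inflate_of_mem (sfClass_mono hρε) hU hmem

/-- **CAPTURE COMPOSES**: CAPTURE(ε → ε′) and CAPTURE(ε′ → ρ) on `D`, `ε′ ≤ ε`, give CAPTURE(ε → ρ) (the captured `ε`-minimiser is an `ε′`-minimiser). [folklore] -/
theorem capture_trans {L N : ℕ} {ε ε' ρ : ℝ} (hε'ε : ε' ≤ ε) {D : Set (Site d → Fin d → (Matrix n n ℂ)ˣ)}
    (h₁ : ∀ V ∈ D, ∀ (k : ℕ) (U : Site d → Fin d → (Matrix n n ℂ)ˣ), IsMinimiser d (sfClass d L N ε) L N (k + 1) V U → U ∈ sfClass d L N ε' (k + 1))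
    (h₂ : ∀ V ∈ D, ∀ (k : ℕ) (U : Site d → Fin d → (Matrix n n ℂ)ˣ), IsMinimiser d (sfClass d L N ε') L N (k + 1) V U → U ∈ sfClass d L N ρ (k + 1)) :
    ∀ V ∈ D, ∀ (k : ℕ) (U : Site d → Fin d → (Matrix n n ℂ)ˣ), IsMinimiser d (sfClass d L N ε) L N (k + 1) V U → U ∈ sfClass d L N ρ (k + 1) :=
  fun V hV k U hU => h₂ V hV k U (isMinimiser_of_capture hε'ε hU (h₁ V hV k U hU))

/-- **CAPTURE IS INHERITED BY EVERY INTERMEDIATE CLASS RADIUS**: if CAPTURE(ε → ρ) holds on `D` and every datum of `D` carries an `ε`-minimiser of every run `k+1`, then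
CAPTURE(ε′ → ρ) holds for every `ρ ≤ ε′ ≤ ε`.  Proof: the `ε`-minimiser `U` lies in `sfClass ρ ⊆ sfClass ε′`, so `A^{ε′} = A^{ε}` and every `ε′`-minimiser is an
`ε`-minimiser (file 4's `isMinimiser_inflate_of_minAct_le`), hence captured. [folklore] -/
theorem capture_mono_outer {L N : ℕ} {ε ε' ρ : ℝ} (hρε' : ρ ≤ ε') (hε'ε : ε' ≤ ε) {D : Set (Site d → Fin d → (Matrix n n ℂ)ˣ)}
    (hcap : ∀ V ∈ D, ∀ (k : ℕ) (U : Site d → Fin d → (Matrix n n ℂ)ˣ), IsMinimiser d (sfClass d L N ε) L N (k + 1) V U → U ∈ sfClass d L N ρ (k + 1))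
    (hex : ∀ V ∈ D, ∀ k : ℕ, ∃ U : Site d → Fin d → (Matrix n n ℂ)ˣ, IsMinimiser d (sfClass d L N ε) L N (k + 1) V U) :
    ∀ V ∈ D, ∀ (k : ℕ) (U' : Site d → Fin d → (Matrix n n ℂ)ˣ), IsMinimiser d (sfClass d L N ε') L N (k + 1) V U' → U' ∈ sfClass d L N ρ (k + 1) := by
  intro V hV k U' hU'
  obtain ⟨U, hU⟩ := hex V hV k
  have hUε' : IsMinimiser d (sfClass d L N ε') L N (k + 1) V U :=
    isMinimiser_of_capture hε'ε hU (sfClass_mono hρε' (hcap V hV k U hU))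
  have hle : minAct d (sfClass d L N ε') L N (k + 1) V ≤ minAct d (sfClass d L N ε) L N (k + 1) V :=
    le_of_eq (by rw [hUε'.minAct_eq, hU.minAct_eq])
  exact hcap V hV k U' (isMinimiser_inflate_of_minAct_le (sfClass_mono hε'ε) hU' hU hle)

/-- **VALUE NO-BINDING DOWNWARD**: an `ε`-minimiser captured in `sfClass ρ` fixes the minimal action of EVERY intermediate class, `A^{ε′}_{k}(V) = A^{ε}_{k}(V)` for
`ρ ≤ ε′ ≤ ε` (it is a minimiser of each of them). [folklore] -/
theorem minAct_eq_of_capture {L N k : ℕ} {ε ε' ρ : ℝ} (hρε' : ρ ≤ ε') (hε'ε : ε' ≤ ε) {V U : Site d → Fin d → (Matrix n n ℂ)ˣ}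
    (hU : IsMinimiser d (sfClass d L N ε) L N k V U) (hmem : U ∈ sfClass d L N ρ k) :
    minAct d (sfClass d L N ε') L N k V = minAct d (sfClass d L N ε) L N k V := by
  rw [(isMinimiser_of_capture hε'ε hU (sfClass_mono hρε' hmem)).minAct_eq, hU.minAct_eq]

/-! ## §2 Sufficiency modulo Theorem 1: the interior leaf from CAPTURE, and the equivalence -/

/-- **★ THE INTERIOR LEAF FROM [B11] THEOREM 1 AT THE TORUS INSTANCES AND CAPTURE.**  Let `L ≥ 1`; `G`, `hGm`, `hG`, `C`, `hM` and
`hT : ∀ k, Thm1At C (torusVP d L N G (k+1))` exactly as in file 1 §3 (the (9)_{β₀=1} interface and [Balaban1985Variational] Theorem 1 at leaf-06's torus instances, DISPLAYED);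
a capture radius `0 < ρ ≤ ε` with `ρ ≤ B₃a₁`, `ρ ≤ 1∕28`; data `D` loose at `ρ∕B₃` (print's (7) at `ε₁ = ρ∕B₃`); and CAPTURE(ε → ρ) on `D` (DISPLAYED; print's uniqueness
picture, NOT proved here).  THEN `LeafH3sup d L N ε ρ (16937·ρ) D`: every minimiser of every run `k+1` over the class of radius `ε` at a datum of `D` has sup-form regularity
with VALUE letter `ρ` and gradient letter `16937ρ` — the interior letter.  Proof: the captured `ε`-minimiser is a `ρ`-minimiser (§1), and file 1's
`leafH3sup_loose_of_thm1At_torusVP` at radius `ρ` is Theorem 1 (8)–(10) for it. [cite: Balaban1985Variational, Thm 1 (8)–(10) p.279] -/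
theorem leafH3sup_interior_of_thm1At_torusVP_of_capture [Nonempty n] {L N : ℕ} (hL : 1 ≤ L)
    {G : (Site d → Fin d → (Matrix n n ℂ)ˣ) → Site d → ℕ → ℝ → ℝ → ℝ → Prop} (hGm : RadiiMono d G)
    (hG : ∀ (U : Site d → Fin d → (Matrix n n ℂ)ˣ) (x : Site d) (K : ℕ) (α₀ α₁ α₂ : ℝ), 2 ≤ K → G U x K α₀ α₁ α₂ →
      ∃ (u : Site d → (Matrix n n ℂ)ˣ) (a : Site d → Fin d → Matrix n n ℂ),
        (∀ z, u z ∈ unitaryUnits (Matrix n n ℂ)) ∧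
        (∀ (y : Site d) (τ : Fin d), l1 (y - x) ≤ 2 → ((gaugeAct u U y τ : (Matrix n n ℂ)ˣ) : Matrix n n ℂ) = exp (a y τ)) ∧
        (∀ (y : Site d) (τ : Fin d), l1 (y - x) ≤ 2 → ‖a y τ‖ ≤ α₀) ∧
        (∀ (y : Site d) (τ i : Fin d), l1 (y - x) ≤ 1 → ‖fd i (fun z => a z τ) y‖ ≤ α₁) ∧
        (∀ (τ i l : Fin d), ‖fd i (fd l (fun z => a z τ)) x‖ ≤ α₂))
    (C : B11Thm1.Consts) (hM : ∀ e : ℝ, 0 < e → e ≤ C.a₁ → 7 / 2 ≤ C.Mfun e)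
    (hT : ∀ k : ℕ, Thm1At C (torusVP d L N G (k + 1)))
    {ε ρ : ℝ} (hρ : 0 < ρ) (hρε : ρ ≤ ε) (hρa : ρ ≤ C.B₃ * C.a₁) (hρ28 : ρ ≤ 1 / 28)
    {D : Set (Site d → Fin d → (Matrix n n ℂ)ˣ)} (hD : D ⊆ sfClass d L N (ρ / C.B₃) 0)
    (hcap : ∀ V ∈ D, ∀ (k : ℕ) (U : Site d → Fin d → (Matrix n n ℂ)ˣ), IsMinimiser d (sfClass d L N ε) L N (k + 1) V U → U ∈ sfClass d L N ρ (k + 1)) :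
    LeafH3sup d L N ε ρ (16937 * ρ) D := by
  have hleaf := leafH3sup_loose_of_thm1At_torusVP hL hGm hG C hM hT hρ hρa hρ28 D
  intro V hV k U hU
  exact hleaf V ⟨hV, hD hV⟩ k U (isMinimiser_of_capture hρε hU (hcap V hV k U hU))

/-- **★ THE EQUIVALENCE**: under Theorem 1 at the torus instances, for a Theorem-1 radius `0 < ρ ≤ min(ε, B₃a₁, 1∕28)` and data loose at `ρ∕B₃`, the interior leaf
`LeafH3sup d L N ε ρ (16937ρ) D` holds IF AND ONLY IF CAPTURE(ε → ρ) holds on `D` — the junction's open content is capture, no more, no less (modulo (9)–(10)).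
[cite: Balaban1985Variational, Thm 1 (8)–(10) p.279] -/
theorem leafH3sup_interior_iff_capture [Nonempty n] {L N : ℕ} (hL : 1 ≤ L)
    {G : (Site d → Fin d → (Matrix n n ℂ)ˣ) → Site d → ℕ → ℝ → ℝ → ℝ → Prop} (hGm : RadiiMono d G)
    (hG : ∀ (U : Site d → Fin d → (Matrix n n ℂ)ˣ) (x : Site d) (K : ℕ) (α₀ α₁ α₂ : ℝ), 2 ≤ K → G U x K α₀ α₁ α₂ →
      ∃ (u : Site d → (Matrix n n ℂ)ˣ) (a : Site d → Fin d → Matrix n n ℂ),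
        (∀ z, u z ∈ unitaryUnits (Matrix n n ℂ)) ∧
        (∀ (y : Site d) (τ : Fin d), l1 (y - x) ≤ 2 → ((gaugeAct u U y τ : (Matrix n n ℂ)ˣ) : Matrix n n ℂ) = exp (a y τ)) ∧
        (∀ (y : Site d) (τ : Fin d), l1 (y - x) ≤ 2 → ‖a y τ‖ ≤ α₀) ∧
        (∀ (y : Site d) (τ i : Fin d), l1 (y - x) ≤ 1 → ‖fd i (fun z => a z τ) y‖ ≤ α₁) ∧
        (∀ (τ i l : Fin d), ‖fd i (fd l (fun z => a z τ)) x‖ ≤ α₂))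
    (C : B11Thm1.Consts) (hM : ∀ e : ℝ, 0 < e → e ≤ C.a₁ → 7 / 2 ≤ C.Mfun e)
    (hT : ∀ k : ℕ, Thm1At C (torusVP d L N G (k + 1)))
    {ε ρ : ℝ} (hρ : 0 < ρ) (hρε : ρ ≤ ε) (hρa : ρ ≤ C.B₃ * C.a₁) (hρ28 : ρ ≤ 1 / 28)
    {D : Set (Site d → Fin d → (Matrix n n ℂ)ˣ)} (hD : D ⊆ sfClass d L N (ρ / C.B₃) 0) :
    LeafH3sup d L N ε ρ (16937 * ρ) D ↔
      ∀ V ∈ D, ∀ (k : ℕ) (U : Site d → Fin d → (Matrix n n ℂ)ˣ), IsMinimiser d (sfClass d L N ε) L N (k + 1) V U → U ∈ sfClass d L N ρ (k + 1) :=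
  ⟨capture_of_leafH3sup, leafH3sup_interior_of_thm1At_torusVP_of_capture hL hGm hG C hM hT hρ hρε hρa hρ28 hD⟩

/-! ## §3 The selection rows: minimisers of every run exist at loose data ((8)), and are regular once captured -/

/-- **(8) ⟹ A MINIMISER OF EVERY RUN `k+1` OVER `sfClass ε` EXISTS AT EVERY LOOSE DATUM** `V ∈ sfClass d L N (ε∕B₃) 0`, for `0 < ε ≤ B₃a₁`: Theorem 1's existence clause (8) at
`ε₁ = ε∕B₃` read at leaf-06's torus instance of run `k+1` (its class `sfClass (B₃ε₁)` IS the class of radius `ε`). [cite: Balaban1985Variational, Thm 1 (8) p.279] -/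
theorem exists_isMinimiser_succ_of_thm1At_torusVP {L N : ℕ} {G : (Site d → Fin d → (Matrix n n ℂ)ˣ) → Site d → ℕ → ℝ → ℝ → ℝ → Prop}
    (C : B11Thm1.Consts) (hT : ∀ k : ℕ, Thm1At C (torusVP d L N G (k + 1)))
    {ε : ℝ} (hε : 0 < ε) (hεa : ε ≤ C.B₃ * C.a₁) {V : Site d → Fin d → (Matrix n n ℂ)ˣ} (hV : V ∈ sfClass d L N (ε / C.B₃) 0) (k : ℕ) :
    ∃ U : Site d → Fin d → (Matrix n n ℂ)ˣ, IsMinimiser d (sfClass d L N ε) L N (k + 1) V U := by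
  have hB₃ := C.B₃_pos
  have hε₁ : 0 < ε / C.B₃ := div_pos hε hB₃
  have hε₁a : ε / C.B₃ ≤ C.a₁ := by rw [div_le_iff₀ hB₃]; linarith [mul_comm C.B₃ C.a₁]
  have hBε : C.B₃ * (ε / C.B₃) = ε := by field_simp
  obtain ⟨⟨U, -, -, hmin⟩, -, -⟩ := hT k (ε / C.B₃) hε₁ hε₁a V hV
  have hmin' : IsMinimiser d (sfClass d L N (C.B₃ * (ε / C.B₃))) L N (k + 1) V U := hmin
  rw [hBε] at hmin'
  exact ⟨U, hmin'⟩

/-- **THE SELECTION AT RUNS `k+1` UNDER CAPTURE**: under §2's hypotheses and the row `ε ≤ B₃a₁`, there is a selection `sel k V` of a minimiser of run `k+1` over `sfClass ε` at every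
datum of `D`, each with sup-form regularity `(ρ, 16937ρ)` — (8) for existence, CAPTURE + (9)–(10) for regularity. [cite: Balaban1985Variational, Thm 1 (8)–(10) p.279] -/
theorem exists_sel_succ_of_thm1At_torusVP_of_capture [Nonempty n] {L N : ℕ} (hL : 1 ≤ L)
    {G : (Site d → Fin d → (Matrix n n ℂ)ˣ) → Site d → ℕ → ℝ → ℝ → ℝ → Prop} (hGm : RadiiMono d G)
    (hG : ∀ (U : Site d → Fin d → (Matrix n n ℂ)ˣ) (x : Site d) (K : ℕ) (α₀ α₁ α₂ : ℝ), 2 ≤ K → G U x K α₀ α₁ α₂ →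
      ∃ (u : Site d → (Matrix n n ℂ)ˣ) (a : Site d → Fin d → Matrix n n ℂ),
        (∀ z, u z ∈ unitaryUnits (Matrix n n ℂ)) ∧
        (∀ (y : Site d) (τ : Fin d), l1 (y - x) ≤ 2 → ((gaugeAct u U y τ : (Matrix n n ℂ)ˣ) : Matrix n n ℂ) = exp (a y τ)) ∧
        (∀ (y : Site d) (τ : Fin d), l1 (y - x) ≤ 2 → ‖a y τ‖ ≤ α₀) ∧
        (∀ (y : Site d) (τ i : Fin d), l1 (y - x) ≤ 1 → ‖fd i (fun z => a z τ) y‖ ≤ α₁) ∧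
        (∀ (τ i l : Fin d), ‖fd i (fd l (fun z => a z τ)) x‖ ≤ α₂))
    (C : B11Thm1.Consts) (hM : ∀ e : ℝ, 0 < e → e ≤ C.a₁ → 7 / 2 ≤ C.Mfun e)
    (hT : ∀ k : ℕ, Thm1At C (torusVP d L N G (k + 1)))
    {ε ρ : ℝ} (hρ : 0 < ρ) (hρε : ρ ≤ ε) (hεa : ε ≤ C.B₃ * C.a₁) (hρ28 : ρ ≤ 1 / 28)
    {D : Set (Site d → Fin d → (Matrix n n ℂ)ˣ)} (hD : D ⊆ sfClass d L N (ρ / C.B₃) 0)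
    (hcap : ∀ V ∈ D, ∀ (k : ℕ) (U : Site d → Fin d → (Matrix n n ℂ)ˣ), IsMinimiser d (sfClass d L N ε) L N (k + 1) V U → U ∈ sfClass d L N ρ (k + 1)) :
    ∃ sel : ℕ → (Site d → Fin d → (Matrix n n ℂ)ˣ) → (Site d → Fin d → (Matrix n n ℂ)ˣ),
      ∀ V ∈ D, ∀ k : ℕ, IsMinimiser d (sfClass d L N ε) L N (k + 1) V (sel k V) ∧ RegularSup d L N ρ (16937 * ρ) (k + 1) (sel k V) := by
  classical
  have hε : 0 < ε := lt_of_lt_of_le hρ hρε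
  have hρa : ρ ≤ C.B₃ * C.a₁ := hρε.trans hεa
  have hDε : D ⊆ sfClass d L N (ε / C.B₃) 0 :=
    fun V hV => sfClass_mono (div_le_div_of_nonneg_right hρε C.B₃_pos.le) (hD hV)
  have hex : ∀ (k : ℕ) (V : Site d → Fin d → (Matrix n n ℂ)ˣ), ∃ U : Site d → Fin d → (Matrix n n ℂ)ˣ,
      V ∈ D → IsMinimiser d (sfClass d L N ε) L N (k + 1) V U := by
    intro k V
    by_cases hV : V ∈ D
    · obtain ⟨U, hU⟩ := exists_isMinimiser_succ_of_thm1At_torusVP C hT hε hεa (hDε hV) k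
      exact ⟨U, fun _ => hU⟩
    · exact ⟨V, fun h => absurd h hV⟩
  choose sel hsel using hex
  have hleaf := leafH3sup_interior_of_thm1At_torusVP_of_capture hL hGm hG C hM hT hρ hρε hρa hρ28 hD hcap
  exact ⟨sel, fun V hV k => ⟨hsel k V hV, hleaf V hV k _ (hsel k V hV)⟩⟩

/-- **★ THE TWO `sel` ROWS OF NODE N19's (v′-16), FROM (8), CAPTURE AND THE LEVEL-0 TRIVIAL LEAF**: with letters `b ≥ ρ`, `c' ≥ 16937ρ` and a datum radius `ε₁` with
`D ⊆ sfClass ε₁ 0`, `ε₁ ≤ min(ε, 1∕4, b, c'∕4)` (N19's own rows), there is ONE selection with `IsMinimiser … k V (sel k V)` and `RegularSup … b c' k (sel k V)` for EVERY run `k`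
— run `0`: the datum itself (`isMinimiser_zero`, `Support/LevelZeroRegular.regularSup_zero_of_sfClass_le`); runs `k+1`: the previous theorem. [cite: Balaban1985Variational, Thm 1 (8)–(10) p.279] -/
theorem exists_sel_of_thm1At_torusVP_of_capture [Nonempty n] {L N : ℕ} (hL : 1 ≤ L)
    {G : (Site d → Fin d → (Matrix n n ℂ)ˣ) → Site d → ℕ → ℝ → ℝ → ℝ → Prop} (hGm : RadiiMono d G)
    (hG : ∀ (U : Site d → Fin d → (Matrix n n ℂ)ˣ) (x : Site d) (K : ℕ) (α₀ α₁ α₂ : ℝ), 2 ≤ K → G U x K α₀ α₁ α₂ →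
      ∃ (u : Site d → (Matrix n n ℂ)ˣ) (a : Site d → Fin d → Matrix n n ℂ),
        (∀ z, u z ∈ unitaryUnits (Matrix n n ℂ)) ∧
        (∀ (y : Site d) (τ : Fin d), l1 (y - x) ≤ 2 → ((gaugeAct u U y τ : (Matrix n n ℂ)ˣ) : Matrix n n ℂ) = exp (a y τ)) ∧
        (∀ (y : Site d) (τ : Fin d), l1 (y - x) ≤ 2 → ‖a y τ‖ ≤ α₀) ∧
        (∀ (y : Site d) (τ i : Fin d), l1 (y - x) ≤ 1 → ‖fd i (fun z => a z τ) y‖ ≤ α₁) ∧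
        (∀ (τ i l : Fin d), ‖fd i (fd l (fun z => a z τ)) x‖ ≤ α₂))
    (C : B11Thm1.Consts) (hM : ∀ e : ℝ, 0 < e → e ≤ C.a₁ → 7 / 2 ≤ C.Mfun e)
    (hT : ∀ k : ℕ, Thm1At C (torusVP d L N G (k + 1)))
    {ε ρ b c' ε₁ : ℝ} (hρ : 0 < ρ) (hρε : ρ ≤ ε) (hεa : ε ≤ C.B₃ * C.a₁) (hρ28 : ρ ≤ 1 / 28) (hρb : ρ ≤ b) (hρc : 16937 * ρ ≤ c')
    (hε₁ε : ε₁ ≤ ε) (hε₁ : ε₁ ≤ 1 / 4) (hε₁b : ε₁ ≤ b) (hε₁c : 4 * ε₁ ≤ c')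
    {D : Set (Site d → Fin d → (Matrix n n ℂ)ˣ)} (hD : D ⊆ sfClass d L N (ρ / C.B₃) 0) (hD₁ : D ⊆ sfClass d L N ε₁ 0)
    (hcap : ∀ V ∈ D, ∀ (k : ℕ) (U : Site d → Fin d → (Matrix n n ℂ)ˣ), IsMinimiser d (sfClass d L N ε) L N (k + 1) V U → U ∈ sfClass d L N ρ (k + 1)) :
    ∃ sel : ℕ → (Site d → Fin d → (Matrix n n ℂ)ˣ) → (Site d → Fin d → (Matrix n n ℂ)ˣ),
      (∀ V ∈ D, ∀ k : ℕ, IsMinimiser d (sfClass d L N ε) L N k V (sel k V)) ∧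
      (∀ V ∈ D, ∀ k : ℕ, RegularSup d L N b c' k (sel k V)) := by
  obtain ⟨sel, hsel⟩ := exists_sel_succ_of_thm1At_torusVP_of_capture hL hGm hG C hM hT hρ hρε hεa hρ28 hD hcap
  refine ⟨fun k V => match k with | 0 => V | k + 1 => sel k V, fun V hV k => ?_, fun V hV k => ?_⟩
  · cases k with
    | zero => exact isMinimiser_zero (sfClass_mono hε₁ε (hD₁ hV))
    | succ k => exact (hsel V hV k).1
  · cases k with
    | zero => exact regularSup_zero_of_sfClass_le hε₁ hε₁b hε₁c (hD₁ hV)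
    | succ k => exact ((hsel V hV k).2).mono hρb hρc

end Generic

/-! ## §4 At K3⁷ v5's LOOSE PIN: node N19's (v′-16) rows at `rateCarriersOfRecord₁₃CoPH 𝔯 F θ hP g₀ os k` from CAPTURE and Theorem 1 -/

section AtReading

variable {N : ℕ} [NeZero N]

/-- **★ NODE N19's (v′-16) CONJUNCT `LeafH3sup 4 R.ne3.L R.ne3.Nper R.ne3.ε R.ne3.b c' R.ne3.dom` AT EVERY TUPLE AND RUN LENGTH, UNDER THE LOOSE PIN, FROM CAPTURE AND
THEOREM 1.**  Hypotheses: the pin `N16PinnedLoose 𝔯 ℓ₃ B` (module 43, = K3⁷ v5's N16 pin); a capture radius `ρ : T4Family → ℝ` with the DISPLAYED rows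
`0 < ρ F`, `ρ F ≤ (ℓ₃ F).ε`, `ρ F ≤ (C F).B₃·(C F).a₁`, `ρ F ≤ 1∕28`, `(ℓ₃ F).ε ∕ B F ≤ ρ F ∕ (C F).B₃` (the pinned data are (7)-loose for Theorem 1 at `ε₁ = ρ F∕B₃`); the
TIGHTENED MATCH ROW `ρ F ≤ (ℓ₃ F).b` and `16937·ρ F ≤ c'`; per family the Theorem-1 reading `G F`, `hGm`, `hG`, `C F`, `hM`, `hT` (exactly module 45's binders; DISPLAYED); and
CAPTURE((ℓ₃ F).ε → ρ F) at the pinned loose object (DISPLAYED; print's uniqueness picture; NOT proved).  Conclusion: N19's clause at `R := rateCarriersOfRecord₁₃CoPH 𝔯 F θ hP g₀ os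
k` (module 43's `rateCarriers_ne3_of_pinnedLoose` rewrites `R.ne3` to the loose object; its letters are `F.L`, `ne3NperOfRecord₁₁ F 0 0`, `(ℓ₃ F).ε`, `(ℓ₃ F).b` by `rfl`).
N19's rows stay displayed on its side; this is a producer modulo CAPTURE, not a discharge. [cite: Balaban1985Variational, Thm 1 (8)–(10) p.279] -/
theorem leafH3sup_rateCarriers_of_pinnedLoose_of_capture {𝔯 : RateReading₁₃CoPH N} {ℓ₃ : T4Family → NE3Letters₁₁} {B : T4Family → ℝ}
    (hpin : N16PinnedLoose 𝔯 ℓ₃ B)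
    {G : T4Family → (Site 4 → Fin 4 → (MatA N)ˣ) → Site 4 → ℕ → ℝ → ℝ → ℝ → Prop} (hGm : ∀ F, RadiiMono 4 (G F))
    (hG : ∀ (F : T4Family) (U : Site 4 → Fin 4 → (MatA N)ˣ) (x : Site 4) (K : ℕ) (α₀ α₁ α₂ : ℝ), 2 ≤ K → G F U x K α₀ α₁ α₂ →
      ∃ (u : Site 4 → (MatA N)ˣ) (a : Site 4 → Fin 4 → MatA N),
        (∀ z, u z ∈ unitaryUnits (MatA N)) ∧
        (∀ (y : Site 4) (τ : Fin 4), l1 (y - x) ≤ 2 → ((gaugeAct u U y τ : (MatA N)ˣ) : MatA N) = exp (a y τ)) ∧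
        (∀ (y : Site 4) (τ : Fin 4), l1 (y - x) ≤ 2 → ‖a y τ‖ ≤ α₀) ∧
        (∀ (y : Site 4) (τ i : Fin 4), l1 (y - x) ≤ 1 → ‖fd i (fun z => a z τ) y‖ ≤ α₁) ∧
        (∀ (τ i l : Fin 4), ‖fd i (fd l (fun z => a z τ)) x‖ ≤ α₂))
    (C : T4Family → B11Thm1.Consts) (hM : ∀ (F : T4Family) (e : ℝ), 0 < e → e ≤ (C F).a₁ → 7 / 2 ≤ (C F).Mfun e)
    (hT : ∀ (F : T4Family) (k : ℕ), Thm1At (C F) (torusVP 4 F.L (ne3NperOfRecord₁₁ F 0 0) (G F) (k + 1)))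
    {ρ : T4Family → ℝ}
    (hρ : ∀ F : T4Family, 0 < ρ F ∧ ρ F ≤ (ℓ₃ F).ε ∧ ρ F ≤ (C F).B₃ * (C F).a₁ ∧ ρ F ≤ 1 / 28 ∧ (ℓ₃ F).ε / B F ≤ ρ F / (C F).B₃)
    (hcap : ∀ (F : T4Family), ∀ V ∈ ({V | V ∈ ne3DomOfRecord₁₁ F N 0 0 ∧ V ∈ sfClass 4 F.L (ne3NperOfRecord₁₁ F 0 0) ((ℓ₃ F).ε / B F) 0} :
        Set (Site 4 → Fin 4 → (MatA N)ˣ)), ∀ (k : ℕ) (U : Site 4 → Fin 4 → (MatA N)ˣ),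
      IsMinimiser 4 (sfClass 4 F.L (ne3NperOfRecord₁₁ F 0 0) (ℓ₃ F).ε) F.L (ne3NperOfRecord₁₁ F 0 0) (k + 1) V U →
        U ∈ sfClass 4 F.L (ne3NperOfRecord₁₁ F 0 0) (ρ F) (k + 1))
    (F : T4Family) (θ : Stage13HParams F N) (hP : θ.Provisos₁₃CoPH F N) (g₀ : ℕ → ℝ) (os : List (ULoop F)) (k : ℕ)
    {c' : ℝ} (hρb : ρ F ≤ (ℓ₃ F).b) (hρc : 16937 * ρ F ≤ c') :
    LeafH3sup 4 (rateCarriersOfRecord₁₃CoPH 𝔯 F θ hP g₀ os k).ne3.L (rateCarriersOfRecord₁₃CoPH 𝔯 F θ hP g₀ os k).ne3.Nper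
      (rateCarriersOfRecord₁₃CoPH 𝔯 F θ hP g₀ os k).ne3.ε (rateCarriersOfRecord₁₃CoPH 𝔯 F θ hP g₀ os k).ne3.b c'
      (rateCarriersOfRecord₁₃CoPH 𝔯 F θ hP g₀ os k).ne3.dom := by
  obtain ⟨hρ0, hρε, hρa, hρ28, hεB⟩ := hρ F
  have hL1 : 1 ≤ F.L := le_trans one_le_two (HistoryFlow.two_le_L F)
  have hD : ({V | V ∈ ne3DomOfRecord₁₁ F N 0 0 ∧ V ∈ sfClass 4 F.L (ne3NperOfRecord₁₁ F 0 0) ((ℓ₃ F).ε / B F) 0} : Set (Site 4 → Fin 4 → (MatA N)ˣ)) ⊆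
      sfClass 4 F.L (ne3NperOfRecord₁₁ F 0 0) (ρ F / (C F).B₃) 0 :=
    fun V hV => sfClass_zero_mono hεB hV.2
  rw [rateCarriers_ne3_of_pinnedLoose hpin F θ hP g₀ os k]
  exact leafH3sup_mono (leafH3sup_interior_of_thm1At_torusVP_of_capture hL1 (hGm F) (hG F) (C F) (hM F) (hT F) hρ0 hρε hρa hρ28 hD (hcap F)) hρb hρc

/-- **THE INSTANCE AT PRINT'S RADIUS `ρ F := (C F).B₃·((ℓ₃ F).ε ∕ B F)`** (= `B₃ε₁` at the pinned data radius `ε₁ = (ℓ₃ F).ε ∕ B F` — where (8) puts THE minimal orbit): the rows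
become `(C F).B₃ ≤ B F` (module 45's), `(ℓ₃ F).ε ∕ B F ≤ (C F).a₁`, `(C F).B₃·((ℓ₃ F).ε ∕ B F) ≤ 1∕28`, the TIGHTENED MATCH ROW `(C F).B₃·((ℓ₃ F).ε ∕ B F) ≤ (ℓ₃ F).b`
(dag-n16-e's (t-N16c) §5 (R1) prediction, verbatim) and `16937·(C F).B₃·((ℓ₃ F).ε ∕ B F) ≤ c'`; CAPTURE is into `sfClass ((C F).B₃·((ℓ₃ F).ε ∕ B F))`.
[cite: Balaban1985Variational, Thm 1 (8)–(10) p.279] -/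
theorem leafH3sup_rateCarriers_of_pinnedLoose_of_capture_B₃ {𝔯 : RateReading₁₃CoPH N} {ℓ₃ : T4Family → NE3Letters₁₁} {B : T4Family → ℝ}
    (hpin : N16PinnedLoose 𝔯 ℓ₃ B)
    {G : T4Family → (Site 4 → Fin 4 → (MatA N)ˣ) → Site 4 → ℕ → ℝ → ℝ → ℝ → Prop} (hGm : ∀ F, RadiiMono 4 (G F))
    (hG : ∀ (F : T4Family) (U : Site 4 → Fin 4 → (MatA N)ˣ) (x : Site 4) (K : ℕ) (α₀ α₁ α₂ : ℝ), 2 ≤ K → G F U x K α₀ α₁ α₂ →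
      ∃ (u : Site 4 → (MatA N)ˣ) (a : Site 4 → Fin 4 → MatA N),
        (∀ z, u z ∈ unitaryUnits (MatA N)) ∧
        (∀ (y : Site 4) (τ : Fin 4), l1 (y - x) ≤ 2 → ((gaugeAct u U y τ : (MatA N)ˣ) : MatA N) = exp (a y τ)) ∧
        (∀ (y : Site 4) (τ : Fin 4), l1 (y - x) ≤ 2 → ‖a y τ‖ ≤ α₀) ∧
        (∀ (y : Site 4) (τ i : Fin 4), l1 (y - x) ≤ 1 → ‖fd i (fun z => a z τ) y‖ ≤ α₁) ∧
        (∀ (τ i l : Fin 4), ‖fd i (fd l (fun z => a z τ)) x‖ ≤ α₂))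
    (C : T4Family → B11Thm1.Consts) (hM : ∀ (F : T4Family) (e : ℝ), 0 < e → e ≤ (C F).a₁ → 7 / 2 ≤ (C F).Mfun e)
    (hT : ∀ (F : T4Family) (k : ℕ), Thm1At (C F) (torusVP 4 F.L (ne3NperOfRecord₁₁ F 0 0) (G F) (k + 1)))
    (hrows : ∀ F : T4Family, 0 < (ℓ₃ F).ε ∧ 0 < B F ∧ (C F).B₃ ≤ B F ∧ (ℓ₃ F).ε / B F ≤ (C F).a₁ ∧ (C F).B₃ * ((ℓ₃ F).ε / B F) ≤ 1 / 28)
    (hcap : ∀ (F : T4Family), ∀ V ∈ ({V | V ∈ ne3DomOfRecord₁₁ F N 0 0 ∧ V ∈ sfClass 4 F.L (ne3NperOfRecord₁₁ F 0 0) ((ℓ₃ F).ε / B F) 0} :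
        Set (Site 4 → Fin 4 → (MatA N)ˣ)), ∀ (k : ℕ) (U : Site 4 → Fin 4 → (MatA N)ˣ),
      IsMinimiser 4 (sfClass 4 F.L (ne3NperOfRecord₁₁ F 0 0) (ℓ₃ F).ε) F.L (ne3NperOfRecord₁₁ F 0 0) (k + 1) V U →
        U ∈ sfClass 4 F.L (ne3NperOfRecord₁₁ F 0 0) ((C F).B₃ * ((ℓ₃ F).ε / B F)) (k + 1))
    (F : T4Family) (θ : Stage13HParams F N) (hP : θ.Provisos₁₃CoPH F N) (g₀ : ℕ → ℝ) (os : List (ULoop F)) (k : ℕ)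
    {c' : ℝ} (hmatch : (C F).B₃ * ((ℓ₃ F).ε / B F) ≤ (ℓ₃ F).b) (hc' : 16937 * ((C F).B₃ * ((ℓ₃ F).ε / B F)) ≤ c') :
    LeafH3sup 4 (rateCarriersOfRecord₁₃CoPH 𝔯 F θ hP g₀ os k).ne3.L (rateCarriersOfRecord₁₃CoPH 𝔯 F θ hP g₀ os k).ne3.Nper
      (rateCarriersOfRecord₁₃CoPH 𝔯 F θ hP g₀ os k).ne3.ε (rateCarriersOfRecord₁₃CoPH 𝔯 F θ hP g₀ os k).ne3.b c'
      (rateCarriersOfRecord₁₃CoPH 𝔯 F θ hP g₀ os k).ne3.dom := by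
  refine leafH3sup_rateCarriers_of_pinnedLoose_of_capture hpin hGm hG C hM hT (ρ := fun F => (C F).B₃ * ((ℓ₃ F).ε / B F))
    (fun F => ?_) hcap F θ hP g₀ os k hmatch hc'
  obtain ⟨hε, hB, hB₃B, ha₁, h28⟩ := hrows F
  have hB₃ := (C F).B₃_pos
  have hq : 0 < (ℓ₃ F).ε / B F := div_pos hε hB
  refine ⟨mul_pos hB₃ hq, ?_, ?_, h28, le_of_eq ?_⟩
  · -- `B₃·(ε∕B) ≤ ε` since `B₃ ≤ B`
    calc (C F).B₃ * ((ℓ₃ F).ε / B F) ≤ B F * ((ℓ₃ F).ε / B F) := mul_le_mul_of_nonneg_right hB₃B hq.le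
      _ = (ℓ₃ F).ε := mul_div_cancel₀ _ hB.ne'
  · exact mul_le_mul_of_nonneg_left ha₁ hB₃.le
  · rw [mul_div_cancel_left₀ _ hB₃.ne']

/-- **★ NODE N19's (v′-16) `sel` ROWS AT EVERY TUPLE AND RUN LENGTH, UNDER THE LOOSE PIN, FROM (8), CAPTURE AND THE LEVEL-0 LEAF**: with the rows of
`leafH3sup_rateCarriers_of_pinnedLoose_of_capture`, the extra existence row `(ℓ₃ F).ε ≤ (C F).B₃·(C F).a₁` ((8) at the class radius itself) and N19's own datum-radius rows at
`ε₁ := (ℓ₃ F).ε ∕ B F` (`ε₁ ≤ (ℓ₃ F).ε`, `ε₁ ≤ 1∕4`, `ε₁ ≤ (ℓ₃ F).b` — the MATCH row —, `4ε₁ ≤ c'`), ONE selection serves both displayed rows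
`∀ V ∈ R.ne3.dom, ∀ k, IsMinimiser 4 (sfClass 4 R.ne3.L R.ne3.Nper R.ne3.ε) R.ne3.L R.ne3.Nper k V (sel k V)` and `∀ V ∈ R.ne3.dom, ∀ k, RegularSup 4 R.ne3.L R.ne3.Nper R.ne3.b c' k (sel k V)`.
[cite: Balaban1985Variational, Thm 1 (8)–(10) p.279] -/
theorem sel_rateCarriers_of_pinnedLoose_of_capture {𝔯 : RateReading₁₃CoPH N} {ℓ₃ : T4Family → NE3Letters₁₁} {B : T4Family → ℝ}
    (hpin : N16PinnedLoose 𝔯 ℓ₃ B)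
    {G : T4Family → (Site 4 → Fin 4 → (MatA N)ˣ) → Site 4 → ℕ → ℝ → ℝ → ℝ → Prop} (hGm : ∀ F, RadiiMono 4 (G F))
    (hG : ∀ (F : T4Family) (U : Site 4 → Fin 4 → (MatA N)ˣ) (x : Site 4) (K : ℕ) (α₀ α₁ α₂ : ℝ), 2 ≤ K → G F U x K α₀ α₁ α₂ →
      ∃ (u : Site 4 → (MatA N)ˣ) (a : Site 4 → Fin 4 → MatA N),
        (∀ z, u z ∈ unitaryUnits (MatA N)) ∧
        (∀ (y : Site 4) (τ : Fin 4), l1 (y - x) ≤ 2 → ((gaugeAct u U y τ : (MatA N)ˣ) : MatA N) = exp (a y τ)) ∧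
        (∀ (y : Site 4) (τ : Fin 4), l1 (y - x) ≤ 2 → ‖a y τ‖ ≤ α₀) ∧
        (∀ (y : Site 4) (τ i : Fin 4), l1 (y - x) ≤ 1 → ‖fd i (fun z => a z τ) y‖ ≤ α₁) ∧
        (∀ (τ i l : Fin 4), ‖fd i (fd l (fun z => a z τ)) x‖ ≤ α₂))
    (C : T4Family → B11Thm1.Consts) (hM : ∀ (F : T4Family) (e : ℝ), 0 < e → e ≤ (C F).a₁ → 7 / 2 ≤ (C F).Mfun e)
    (hT : ∀ (F : T4Family) (k : ℕ), Thm1At (C F) (torusVP 4 F.L (ne3NperOfRecord₁₁ F 0 0) (G F) (k + 1)))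
    {ρ : T4Family → ℝ}
    (hρ : ∀ F : T4Family, 0 < ρ F ∧ ρ F ≤ (ℓ₃ F).ε ∧ ρ F ≤ (C F).B₃ * (C F).a₁ ∧ ρ F ≤ 1 / 28 ∧ (ℓ₃ F).ε / B F ≤ ρ F / (C F).B₃)
    (hεa : ∀ F : T4Family, (ℓ₃ F).ε ≤ (C F).B₃ * (C F).a₁)
    (hε₁ : ∀ F : T4Family, (ℓ₃ F).ε / B F ≤ (ℓ₃ F).ε ∧ (ℓ₃ F).ε / B F ≤ 1 / 4 ∧ (ℓ₃ F).ε / B F ≤ (ℓ₃ F).b)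
    (hcap : ∀ (F : T4Family), ∀ V ∈ ({V | V ∈ ne3DomOfRecord₁₁ F N 0 0 ∧ V ∈ sfClass 4 F.L (ne3NperOfRecord₁₁ F 0 0) ((ℓ₃ F).ε / B F) 0} :
        Set (Site 4 → Fin 4 → (MatA N)ˣ)), ∀ (k : ℕ) (U : Site 4 → Fin 4 → (MatA N)ˣ),
      IsMinimiser 4 (sfClass 4 F.L (ne3NperOfRecord₁₁ F 0 0) (ℓ₃ F).ε) F.L (ne3NperOfRecord₁₁ F 0 0) (k + 1) V U →
        U ∈ sfClass 4 F.L (ne3NperOfRecord₁₁ F 0 0) (ρ F) (k + 1))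
    (F : T4Family) (θ : Stage13HParams F N) (hP : θ.Provisos₁₃CoPH F N) (g₀ : ℕ → ℝ) (os : List (ULoop F)) (k : ℕ)
    {c' : ℝ} (hρb : ρ F ≤ (ℓ₃ F).b) (hρc : 16937 * ρ F ≤ c') (hε₁c : 4 * ((ℓ₃ F).ε / B F) ≤ c') :
    ∃ sel : ℕ → (Site 4 → Fin 4 → (MatA N)ˣ) → (Site 4 → Fin 4 → (MatA N)ˣ),
      (∀ V ∈ (rateCarriersOfRecord₁₃CoPH 𝔯 F θ hP g₀ os k).ne3.dom, ∀ j : ℕ,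
        IsMinimiser 4 (sfClass 4 (rateCarriersOfRecord₁₃CoPH 𝔯 F θ hP g₀ os k).ne3.L (rateCarriersOfRecord₁₃CoPH 𝔯 F θ hP g₀ os k).ne3.Nper
          (rateCarriersOfRecord₁₃CoPH 𝔯 F θ hP g₀ os k).ne3.ε) (rateCarriersOfRecord₁₃CoPH 𝔯 F θ hP g₀ os k).ne3.L
          (rateCarriersOfRecord₁₃CoPH 𝔯 F θ hP g₀ os k).ne3.Nper j V (sel j V)) ∧
      (∀ V ∈ (rateCarriersOfRecord₁₃CoPH 𝔯 F θ hP g₀ os k).ne3.dom, ∀ j : ℕ,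
        RegularSup 4 (rateCarriersOfRecord₁₃CoPH 𝔯 F θ hP g₀ os k).ne3.L (rateCarriersOfRecord₁₃CoPH 𝔯 F θ hP g₀ os k).ne3.Nper
          (rateCarriersOfRecord₁₃CoPH 𝔯 F θ hP g₀ os k).ne3.b c' j (sel j V)) := by
  obtain ⟨hρ0, hρε, -, hρ28, hεB⟩ := hρ F
  obtain ⟨hε₁ε, hε₁4, hε₁b⟩ := hε₁ F
  have hL1 : 1 ≤ F.L := le_trans one_le_two (HistoryFlow.two_le_L F)
  have hD : ({V | V ∈ ne3DomOfRecord₁₁ F N 0 0 ∧ V ∈ sfClass 4 F.L (ne3NperOfRecord₁₁ F 0 0) ((ℓ₃ F).ε / B F) 0} : Set (Site 4 → Fin 4 → (MatA N)ˣ)) ⊆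
      sfClass 4 F.L (ne3NperOfRecord₁₁ F 0 0) (ρ F / (C F).B₃) 0 :=
    fun V hV => sfClass_zero_mono hεB hV.2
  rw [rateCarriers_ne3_of_pinnedLoose hpin F θ hP g₀ os k]
  exact exists_sel_of_thm1At_torusVP_of_capture hL1 (hGm F) (hG F) (C F) (hM F) (hT F) hρ0 hρε (hεa F) hρ28 hρb hρc hε₁ε hε₁4 hε₁b hε₁c hD (fun V hV => hV.2) (hcap F)

end AtReading

end

end Summit.QuantumFields.YangMills.BalabanUVNodes.N16InteriorOfCapture
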